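import Summits.HubbardSuperconductivity.HubbardSuperconductivity.Theorems.AnisotropyChordTransferFibre3RowDBLinesE
import Summits.HubbardSuperconductivity.HubbardSuperconductivity.Theorems.AnisotropyChordTransferFibre3RowDNT
import Summits.HubbardSuperconductivity.HubbardSuperconductivity.Theorems.AnisotropyChordTransferFibre3RowDOffD

/-!
# Route `AnisotropyChord` / H0 rotor rung, row D (KT-2a) Stage-1 evaluator: the DECOMPOSITION of `R̂′(k̄)` — closed `RExpr` pair + loops

Layer H (semantic) of the row-D program (p1 g29 memo ROWD-DESIGN-g29 §6, p1 g30).  At an integer low momentum `k = (k₂,k₃)`, g27's cancelled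
recipe (`rhatCancelled_holds`) + `offDTransform_holds` + `boundaryLines_holds` + the monomial splits of layers D–G
(`vc0form_split`, `mform_split`, `bdry_split`, `psiHat1_split`) give
★ `rhat_decomp`:
`R̂′(k̄) = Σ_{m ∈ monoList} [nvClosedU + mClosedU − bClosedU]_m + loopTot − (T⁺ − 3λ₂)·(ntClosedU + ntLoopU)`,
`loopTot := Σ_m [nvLoopU + mLoopU − bLoopU]_m` (★ `loopTot`), and with the eval theorems of the closed halves
(`nTermE_eval`, `mTermE_eval`, `bTermE_eval`, `ntClosedE_eval`) the closed part is ONE `RExpr` pair: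
★ `rhoE k₂ k₃ := Σ_m (nTermE + mTermE − bTermE)` with ★ `rhoE_eval : V²·t·peval(rhoE) = Σ_m closed_m` under the decidable ★ `rhoOk k₂ k₃`, hence
★ `rhat_decomp_eval : R̂′(k̄) = V²t·peval(rhoE k) + loopTot − (T⁺−3λ₂)·(V²·(ntClosedE k).eval + ntLoopU)`.
(The norm bound with the Stage-1b majorants is the sibling `…RowDRhoBound`.)
Prover seat `hubbard-h0-rotor-p1` g30 (route lead); helper for piece A = stmt-HubbardSuperconductivity-23918 of rung 19089
(`--supports`, helper class).  Nothing here proves superconductivity in the Hubbard model; lemmas for ONE row of ONE conditional reduction;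
the rotor TARGET as originally worded stays FALSE (g15 verdict).  Tree imports only; no sorry.
-/

set_option linter.dupNamespace false
set_option autoImplicit false

open Literature.Analysis.ValidatedNumerics

namespace Summit.HubbardSuperconductivity.HubbardSuperconductivity.Theorems.AnisotropyChord.Transfer.Fibre3

namespace RowD

open RowC L2.N1

variable (L : ℕ) [NeZero L]

/-! ## One monomial: full transform off `D` = closed + loop -/

section mono
variable (Δ lam2 : ℝ) (f : Tor L → ℝ)

/-- the closed part of monomial `(k1,k2,k3)` at `(k₂,k₃)`: `nvClosedU + mClosedU − bClosedU`. -/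
noncomputable def monoClosedU (e0 : Tor L) (k3 k1 k2 : Bool) (k₂ k₃ : Tor L) : ℂ :=
  nvClosedU L Δ lam2 f k3 k1 k2 e0 k₂ k₃ + mClosedU L Δ lam2 f k3 k1 k2 e0 k₂ k₃ - bClosedU L Δ lam2 f k3 k1 k2 k₂ k₃

/-- the loop part of monomial `(k1,k2,k3)`: `nvLoopU + mLoopU − bLoopU`. -/
noncomputable def monoLoopU (e0 : Tor L) (k3 k1 k2 : Bool) (k₂ k₃ : Tor L) : ℂ :=
  nvLoopU L Δ lam2 f k3 k1 k2 e0 k₂ k₃ + mLoopU L Δ lam2 f k3 k1 k2 e0 k₂ k₃ - bLoopU L Δ lam2 f k3 k1 k2 k₂ k₃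

/-- ★ the off-`D` transform of one monomial of `RhatCancelled` = closed + loop (ground profile, `L ≥ 7`, `0 ≤ Δ < 1`). -/
theorem mono_split (hL : 7 ≤ L) (hΔ0 : 0 ≤ Δ) (hΔ1 : Δ < 1) (hf : IsGroundTwoMagnon L Δ lam2 f) (e0 : Tor L)
    (k1 k2 k3 : Bool) (k₂ k₃ : Tor L) :
    cfgDFT L (fun c => if InD L c then 0 else
        vfun L c * ((c0form3 L (slot L Δ f k1) (slot L Δ f k2) (slot L Δ f k3) c : ℝ) : ℂ)
        + mform3 L (slot L Δ f k1) (slot L Δ f k2) (slot L Δ f k3) c) k₂ k₃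
      = monoClosedU L Δ lam2 f e0 k3 k1 k2 k₂ k₃ + monoLoopU L Δ lam2 f e0 k3 k1 k2 k₂ k₃ := by
  have hL5 : 5 ≤ L := by omega
  have hev : ∀ r : Tor L, f (-r) = f r := hf.2.1
  have hf0 : f 0 = 0 := hf.1.1
  obtain ⟨e1, e2, z1, z2⟩ := slotsEvenZero_holds L Δ f hev hf0
  have hse : ∀ k : Bool, (∀ r, slot L Δ f k (-r) = slot L Δ f k r) ∧ slot L Δ f k 0 = 0 := by
    intro k; cases k
    · exact ⟨e1, z1⟩
    · exact ⟨e2, z2⟩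
  obtain ⟨hcorner, hlines⟩ := boundaryLines_holds L (slot L Δ f k1) (slot L Δ f k2) (slot L Δ f k3)
    (hse k1).1 (hse k2).1 (hse k3).1 (hse k1).2 (hse k2).2 (hse k3).2 k₂ k₃
  rw [offDTransform_holds L _ k₂ k₃]
  dsimp only at hcorner hlines
  rw [hcorner, hlines, bdry_split L Δ lam2 f hL hΔ0 hΔ1 hf k3 k1 k2 k₂ k₃, cfgDFT_add',
    vc0form_split L Δ lam2 f hL5 hΔ0 hΔ1 hf k3 k1 k2 e0, mform_split L Δ lam2 f hL5 hΔ0 hΔ1 hf k3 k1 k2 e0]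
  unfold monoClosedU monoLoopU
  ring

end mono

/-! ## The full decomposition -/

section decomp
variable (Δ lam2 : ℝ) (f : Tor L → ℝ)

/-- ★ the total loop part at `(k₂,k₃)`: `Σ_{monoList} monoLoopU`. -/
noncomputable def loopTot (e0 : Tor L) (k₂ k₃ : Tor L) : ℂ :=
  (monoList.map (fun m => monoLoopU L Δ lam2 f e0 m.2.2 m.1 m.2.1 k₂ k₃)).sum

/-- the total closed part at `(k₂,k₃)`: `Σ_{monoList} monoClosedU`. -/
noncomputable def closedTot (e0 : Tor L) (k₂ k₃ : Tor L) : ℂ :=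
  (monoList.map (fun m => monoClosedU L Δ lam2 f e0 m.2.2 m.1 m.2.1 k₂ k₃)).sum

/-- ★ THE DECOMPOSITION: `R̂′(k) = closedTot + loopTot − (T⁺ − 3λ₂)(ntClosedU + ntLoopU)` (ground profile, `L ≥ 7`, any torus `k`). -/
theorem rhat_decomp (hL : 7 ≤ L) (hΔ0 : 0 ≤ Δ) (hΔ1 : Δ < 1) (hf : IsGroundTwoMagnon L Δ lam2 f) (e0 : Tor L) (k₂ k₃ : Tor L) :
    cfgDFT L (resid L Δ f) k₂ k₃
      = closedTot L Δ lam2 f e0 k₂ k₃ + loopTot L Δ lam2 f e0 k₂ k₃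
        - (((Tplus L Δ f - 3 * lam2 : ℝ) : ℂ)) * (ntClosedU L Δ lam2 f e0 k₂ k₃ + ntLoopU L Δ lam2 f e0 k₂ k₃) := by
  have hL5 : 5 ≤ L := by omega
  rw [rhatCancelled_holds L Δ lam2 f (by omega) hf.1 hf.2.1 k₂ k₃, psiHat1_split L Δ lam2 f hL5 hΔ0 hΔ1 hf e0]
  unfold closedTot loopTot
  simp only [monoList, List.map, List.sum_cons, List.sum_nil, add_zero,
    mono_split L Δ lam2 f hL hΔ0 hΔ1 hf e0]
  ring

end decomp

/-! ## The closed part as ONE `RExpr` pair -/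

/-- ★ the closed part of `R̂′(k̄)/(V²t)` as a pair: `Σ_{monoList} (nTermE + mTermE − bTermE)`. -/
def rhoE (k₂ k₃ : ℤ × ℤ) : RExpr × RExpr :=
  psum (monoList.map (fun m => psub (padd (nTermE m.2.2 m.1 m.2.1 k₂ k₃) (mTermE m.2.2 m.1 m.2.1 k₂ k₃)) (bTermE m.2.2 m.1 m.2.1 k₂ k₃)))

/-- ★ the decidable side condition of `rhoE_eval` / `rhat_decomp_eval`. -/
def rhoOk (k₂ k₃ : ℤ × ℤ) : Bool := nOk k₂ k₃ && mOk k₂ k₃ && bOk k₂ k₃ && ntOk k₂ k₃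

section evals
variable (Δ lam2 : ℝ) (f : Tor L → ℝ)

/-- one monomial: `V²t·peval(nTermE + mTermE − bTermE) = monoClosedU(k̄)`. -/
theorem monoE_eval (hL : 7 ≤ L) (hΔ0 : 0 ≤ Δ) (hΔ1 : Δ < 1) (hf : IsGroundTwoMagnon L Δ lam2 f) (hlam : 0 < lam2) (e0 : Tor L)
    (k3 k1 k2 : Bool) {k₂ k₃ : ℤ × ℤ} (hn : nOk k₂ k₃ = true) (hm : mOk k₂ k₃ = true) (hb : bOk k₂ k₃ = true) :
    ((L : ℂ) ^ 2) ^ 2 * ((((2 * Real.pi / L) ^ 2 : ℝ) : ℂ)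
        * peval (2 * Real.pi / L) (xTrueD L Δ lam2 f) (psub (padd (nTermE k3 k1 k2 k₂ k₃) (mTermE k3 k1 k2 k₂ k₃)) (bTermE k3 k1 k2 k₂ k₃)))
      = monoClosedU L Δ lam2 f e0 k3 k1 k2 (B1.toTor L k₂) (B1.toTor L k₃) := by
  have A := nTermE_eval L Δ lam2 f hL hΔ0 hΔ1 hf hlam k3 k1 k2 e0 hn
  have B := mTermE_eval L Δ lam2 f hL hΔ0 hΔ1 hf hlam k3 k1 k2 e0 hm
  have C := bTermE_eval L Δ lam2 f hL hΔ0 hΔ1 hf hlam k3 k1 k2 hb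
  unfold monoClosedU
  rw [← A, ← B, ← C, peval_psub, peval_padd]
  ring

/-- ★ `V²t·peval(rhoE k) = closedTot(k̄)` (ground profile, `L ≥ 7`, `rhoOk k`). -/
theorem rhoE_eval (hL : 7 ≤ L) (hΔ0 : 0 ≤ Δ) (hΔ1 : Δ < 1) (hf : IsGroundTwoMagnon L Δ lam2 f) (hlam : 0 < lam2) (e0 : Tor L)
    {k₂ k₃ : ℤ × ℤ} (hok : rhoOk k₂ k₃ = true) :
    ((L : ℂ) ^ 2) ^ 2 * ((((2 * Real.pi / L) ^ 2 : ℝ) : ℂ) * peval (2 * Real.pi / L) (xTrueD L Δ lam2 f) (rhoE k₂ k₃))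
      = closedTot L Δ lam2 f e0 (B1.toTor L k₂) (B1.toTor L k₃) := by
  simp only [rhoOk, Bool.and_eq_true] at hok
  obtain ⟨⟨⟨hn, hm⟩, hb⟩, -⟩ := hok
  have M := fun (k3 k1 k2 : Bool) => monoE_eval L Δ lam2 f hL hΔ0 hΔ1 hf hlam e0 k3 k1 k2 hn hm hb
  unfold closedTot rhoE
  rw [peval_psum]
  simp only [monoList, List.map, List.sum_cons, List.sum_nil, add_zero]
  rw [← M true false false, ← M false false true, ← M true false true, ← M false true false, ← M false true true,
    ← M true true false, ← M true true true]
  ring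

/-- ★ THE DECOMPOSITION AT AN INTEGER MOMENTUM, closed parts evaluated:
`R̂′(k̄) = V²t·peval(rhoE k) + loopTot(k̄) − (T⁺ − 3λ₂)·(V²·(ntClosedE k).eval + ntLoopU(k̄))`. -/
theorem rhat_decomp_eval (hL : 7 ≤ L) (hΔ0 : 0 ≤ Δ) (hΔ1 : Δ < 1) (hf : IsGroundTwoMagnon L Δ lam2 f) (hlam : 0 < lam2) (e0 : Tor L)
    {k₂ k₃ : ℤ × ℤ} (hok : rhoOk k₂ k₃ = true) :
    cfgDFT L (resid L Δ f) (B1.toTor L k₂) (B1.toTor L k₃)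
      = ((L : ℂ) ^ 2) ^ 2 * ((((2 * Real.pi / L) ^ 2 : ℝ) : ℂ) * peval (2 * Real.pi / L) (xTrueD L Δ lam2 f) (rhoE k₂ k₃))
        + loopTot L Δ lam2 f e0 (B1.toTor L k₂) (B1.toTor L k₃)
        - (((Tplus L Δ f - 3 * lam2 : ℝ) : ℂ))
            * (((L : ℂ) ^ 2) ^ 2 * ((((ntClosedE k₂ k₃).eval (xTrueD L Δ lam2 f) : ℝ)) : ℂ)
               + ntLoopU L Δ lam2 f e0 (B1.toTor L k₂) (B1.toTor L k₃)) := by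
  have hnt : ntOk k₂ k₃ = true := by
    simp only [rhoOk, Bool.and_eq_true] at hok; exact hok.2
  rw [rhat_decomp L Δ lam2 f hL hΔ0 hΔ1 hf e0, rhoE_eval L Δ lam2 f hL hΔ0 hΔ1 hf hlam e0 hok,
    ntClosedE_eval L Δ lam2 f hL hΔ0 hΔ1 hf hlam e0 hnt]

end evals

end RowD

end Summit.HubbardSuperconductivity.HubbardSuperconductivity.Theorems.AnisotropyChord.Transfer.Fibre3
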